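import Summits.CriticalPhenomena.SAWScalingLimit.Theorems.SAWTotalPositivityBoundaryHarnackConverse
import Summits.CriticalPhenomena.SAWScalingLimit.Theorems.CriticalBubbleBound.Negative.CriticalBubbleBoundUnrootedPolygons

/-!
# `BoundaryHarnack ⇒ HalfPlaneBubbleFinite`: the notched half-box arch bound controls all half-plane arches

Route `SAWTotalPositivity`, item stmt-CriticalPhenomena-7120 (`BoundaryHarnack`, support), hardness
direction, link to the typed ledger of the crux chain of `CriticalBubbleBound` (stmt-7117).

`archBound_of_boundaryHarnack` (file `…Converse`) extracts from `BoundaryHarnack` a uniform bound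
`Z_{Λ_N}(b', b) ≤ C` on the critical partition functions of the NOTCHED half-boxes
`Λ_N = ([-N,N] × [0,N]) \ {(0,1)}` between `b' = (-1,0)` and `b = (0,0)`. Here we show that this
controls the full critical HALF-PLANE bubble `A = halfPlaneBubble = Σ_{arches 0 → e₀ in {y ≥ 0}} x_c^{|γ|}`
of `CriticalBubbleBound.Negative` (the planner's foreseen layer-2 crux `HalfPlaneBubble` of the
`CriticalBubbleBound` chain, typed as `HalfPlaneBubbleFinite`): every half-plane arch `γ : 0 → e₀`
of length `n`, translated by `(-1,3)`, becomes a SAW `(-1,3) → (0,3)` of `Λ_N` above row `3`, and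
`(-1,0) → (-1,1) → (-1,2) → (-1,3) · γ · (0,3) → (0,2) → (1,2) → (1,1) → (1,0) → (0,0)` is a SAW
`b' → b` of `Λ_N` of length `n + 8` as soon as `N ≥ n + 3` (it avoids the notch `(0,1)`); the map is
injective, so by exhaustion `A ≤ x_c⁻⁸ · sup_N Z_{Λ_N}(b', b)` (`halfPlaneBubble_le_of_archBound`).
Everything proved; no definitions (the embedding is produced inside `exists_archEmbedding`). [folklore]
-/

noncomputable section

namespace Summit.CriticalPhenomena.SAWScalingLimit.Theorems.BoundaryHarnack.Negative

open Literature.Probability.LatticeModels Literature.Probability.RandomPlanarGeometry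
open Literature.Probability.RandomPlanarGeometry.SAW Set Function
open Summit.CriticalPhenomena.SAWScalingLimit.Theorems.BoundaryHarnack.Realisation
open Summit.CriticalPhenomena.SAWScalingLimit.Theorems.CriticalBubbleBound.Negative
open scoped ENNReal

/-! ### List bookkeeping for the sandwich `stem · (lifted arch) · hook` -/

/-- The support of a sandwich walk `s · q · h` whose outer pieces have prescribed supports. [folklore] -/
theorem support_sandwich {G : SimpleGraph (Site 2)} {a m₁ m₂ z : Site 2}
    (s : G.Walk a m₁) (q : G.Walk m₁ m₂) (h : G.Walk m₂ z) :
    (s.append (q.append h)).support = s.support ++ q.support.tail ++ h.support.tail := by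
  rw [SimpleGraph.Walk.support_append, SimpleGraph.Walk.support_append,
    ← SimpleGraph.Walk.cons_tail_support q]
  simp [List.append_assoc]

/-- Vertices of the tail of the support lie in the support. [folklore] -/
theorem mem_support_of_mem_tail {G : SimpleGraph (Site 2)} {u v w : Site 2} (q : G.Walk u v)
    (hw : w ∈ q.support.tail) : w ∈ q.support := by
  rw [← SimpleGraph.Walk.cons_tail_support q]
  exact List.mem_cons_of_mem _ hw

/-- The start vertex of a self-avoiding walk does not reappear in the tail of its support. [folklore] -/
theorem start_not_mem_tail {G : SimpleGraph (Site 2)} {u v : Site 2} (q : G.Walk u v)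
    (hq : q.support.Nodup) : u ∉ q.support.tail := by
  rw [← SimpleGraph.Walk.cons_tail_support q, List.nodup_cons] at hq
  exact hq.1

/-- **The sandwich is self-avoiding.** If `s` has support `[(-1,0),(-1,1),(-1,2),(-1,3)]`, `h` has
support `[(0,3),(0,2),(1,2),(1,1),(1,0),(0,0)]`, and `q : (-1,3) → (0,3)` is self-avoiding with all
its vertices on or above row `3`, then `s · q · h` is self-avoiding. [folklore] -/
theorem nodup_support_sandwich {G : SimpleGraph (Site 2)}
    (s : G.Walk ![-1, 0] ![-1, 3]) (q : G.Walk ![-1, 3] ![0, 3]) (h : G.Walk ![0, 3] ![0, 0])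
    (hs : s.support = [![-1, 0], ![-1, 1], ![-1, 2], ![-1, 3]])
    (hh : h.support = [![0, 3], ![0, 2], ![1, 2], ![1, 1], ![1, 0], ![0, 0]])
    (hq : q.support.Nodup) (hq3 : ∀ w ∈ q.support, 3 ≤ w 1) :
    (s.append (q.append h)).support.Nodup := by
  rw [support_sandwich, hs, hh]
  simp only [List.tail_cons]
  have htail : q.support.tail.Nodup := by
    rw [← SimpleGraph.Walk.cons_tail_support q, List.nodup_cons] at hq
    exact hq.2
  have hstart : (![-1, 3] : Site 2) ∉ q.support.tail := start_not_mem_tail q hq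
  rw [List.nodup_append]
  refine ⟨?_, by decide, ?_⟩
  · rw [List.nodup_append]
    refine ⟨by decide, htail, ?_⟩
    intro a ha b hb hab
    subst hab
    have hb3 := hq3 a (mem_support_of_mem_tail q hb)
    simp only [List.mem_cons, List.not_mem_nil, or_false] at ha
    rcases ha with rfl | rfl | rfl | rfl
    · exact absurd hb3 (by decide)
    · exact absurd hb3 (by decide)
    · exact absurd hb3 (by decide)
    · exact hstart hb
  · intro a ha b hb hab
    subst hab
    rw [List.mem_append] at ha
    simp only [List.mem_cons, List.not_mem_nil, or_false] at hb
    rcases ha with ha | ha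
    · simp only [List.mem_cons, List.not_mem_nil, or_false] at ha
      rcases ha with rfl | rfl | rfl | rfl <;> rcases hb with h | h | h | h | h <;>
        exact absurd h (by decide)
    · have ha3 := hq3 a (mem_support_of_mem_tail q ha)
      rcases hb with rfl | rfl | rfl | rfl | rfl <;> exact absurd ha3 (by decide)

/-! ### Geometry: the sandwich lies in the notched half-box -/

/-- The outer pieces lie in `Λ_N` for `N ≥ 3`. [folklore] -/
theorem mem_halfBox_of_mem_frame {N : ℕ} (hN : 3 ≤ N) {w : Site 2}
    (hw : w ∈ ([![-1, 0], ![-1, 1], ![-1, 2], ![-1, 3]] : List (Site 2)) ∨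
      w ∈ ([![0, 3], ![0, 2], ![1, 2], ![1, 1], ![1, 0], ![0, 0]] : List (Site 2))) :
    w ∈ halfBox N := by
  rw [mem_halfBox_iff]
  have hN' : (3 : ℤ) ≤ N := by exact_mod_cast hN
  simp only [List.mem_cons, List.not_mem_nil, or_false] at hw
  rcases hw with (rfl | rfl | rfl | rfl) | (rfl | rfl | rfl | rfl | rfl | rfl) <;>
    simp only [Matrix.cons_val_zero, Matrix.cons_val_one] <;> omega

/-- A vertex on or above row `3` within sup-distance `n` of `(-1,3)`… more precisely with
`|w 0 + 1| ≤ n` and `w 1 ≤ n + 3`, lies in `Λ_N` once `N ≥ n + 3`. [folklore] -/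
theorem mem_halfBox_of_bounds {N n : ℕ} (hN : n + 3 ≤ N) {w : Site 2}
    (h0 : |w 0 + 1| ≤ n) (h1 : w 1 ≤ n + 3) (h3 : 3 ≤ w 1) : w ∈ halfBox N := by
  rw [mem_halfBox_iff]
  have hN' : (n : ℤ) + 3 ≤ N := by exact_mod_cast hN
  rw [abs_le] at h0
  refine ⟨by omega, by omega, by omega, by omega, ?_⟩
  rintro ⟨-, h⟩
  omega

/-- Edges of a lattice walk with all vertices in `Λ_N` are edges of the domain graph of `Ω_Λ`
(`N ≥ 2`). [folklore] -/
theorem edges_mem_edgeSet_halfBox {N : ℕ} (hN : 2 ≤ N) {u v : Site 2} (p : (zdGraph 2).Walk u v)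
    (h : ∀ w ∈ p.support, w ∈ halfBox N) :
    ∀ e ∈ p.edges, e ∈ (discreteDomainGraph (halfBoxDomain N) 1).edgeSet := by
  intro e he
  induction e using Sym2.ind with
  | h a b =>
    rw [SimpleGraph.mem_edgeSet]
    exact (adjΛ hN).2 ⟨p.adj_of_mem_edges he,
      h a (p.fst_mem_support_of_mem_edges he), h b (p.snd_mem_support_of_mem_edges he)⟩

/-! ### The embedding of half-plane arches into the notched half-box -/

/-- **Embedding.** For `N ≥ 3` there is an injective map from the half-plane arches `0 → e₀` of
length `≤ N - 3` to the SAWs `b' → b` of the notched half-box `Λ_N` (mesh `1`), raising the length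
by exactly `8`: translate by `(-1,3)` and add the stem `(-1,0) → (-1,3)` and the hook
`(0,3) → (0,2) → (1,2) → (1,1) → (1,0) → (0,0)` around the notch `(0,1)`. [folklore] -/
theorem exists_archEmbedding {N : ℕ} (hN : 3 ≤ N) :
    ∃ T : {p : HalfPlaneSAW // p.1.1.length + 3 ≤ N} → DomainSAW (halfBoxDomain N) 1 ![-1, 0] ![0, 0],
      Injective T ∧ ∀ p, (T p).length = p.1.1.1.length + 8 := by
  classical
  have hN2 : 2 ≤ N := le_trans (by norm_num) hN
  -- the shift and the two outer pieces
  set c : Site 2 := ![-1, 3] with hc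
  have h0c : (shiftIso c) (0 : Site 2) = ![-1, 3] := by
    show (0 : Site 2) + c = _; rw [hc]; simp
  have hec : (shiftIso c) e₀ = ![0, 3] := by
    show e₀ + c = _; rw [hc]; unfold e₀; decide
  let s : (zdGraph 2).Walk (![-1, 0] : Site 2) ![-1, 3] :=
    SimpleGraph.Walk.cons (show (zdGraph 2).Adj (![-1, 0] : Site 2) ![-1, 1] by decide)
      (SimpleGraph.Walk.cons (show (zdGraph 2).Adj (![-1, 1] : Site 2) ![-1, 2] by decide)
        (SimpleGraph.Walk.cons (show (zdGraph 2).Adj (![-1, 2] : Site 2) ![-1, 3] by decide)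
          SimpleGraph.Walk.nil))
  let h : (zdGraph 2).Walk (![0, 3] : Site 2) ![0, 0] :=
    SimpleGraph.Walk.cons (show (zdGraph 2).Adj (![0, 3] : Site 2) ![0, 2] by decide)
      (SimpleGraph.Walk.cons (show (zdGraph 2).Adj (![0, 2] : Site 2) ![1, 2] by decide)
        (SimpleGraph.Walk.cons (show (zdGraph 2).Adj (![1, 2] : Site 2) ![1, 1] by decide)
          (SimpleGraph.Walk.cons (show (zdGraph 2).Adj (![1, 1] : Site 2) ![1, 0] by decide)
            (SimpleGraph.Walk.cons (show (zdGraph 2).Adj (![1, 0] : Site 2) ![0, 0] by decide)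
              SimpleGraph.Walk.nil))))
  have hs : s.support = [![-1, 0], ![-1, 1], ![-1, 2], ![-1, 3]] := rfl
  have hh : h.support = [![0, 3], ![0, 2], ![1, 2], ![1, 1], ![1, 0], ![0, 0]] := rfl
  have hsl : s.length = 3 := rfl
  have hhl : h.length = 5 := rfl
  -- the lifted arch
  let q : HalfPlaneSAW → (zdGraph 2).Walk (![-1, 3] : Site 2) ![0, 3] := fun p =>
    (p.1.1.map (shiftIso c).toHom).copy h0c hec
  have hq_supp : ∀ p : HalfPlaneSAW, (q p).support = p.1.1.support.map (fun w => w + c) := by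
    intro p
    show ((p.1.1.map (shiftIso c).toHom).copy h0c hec).support = _
    rw [SimpleGraph.Walk.support_copy, SimpleGraph.Walk.support_map]
    rfl
  have hq_len : ∀ p : HalfPlaneSAW, (q p).length = p.1.1.length := by
    intro p
    show ((p.1.1.map (shiftIso c).toHom).copy h0c hec).length = _
    rw [SimpleGraph.Walk.length_copy, SimpleGraph.Walk.length_map]
  have hq_nodup : ∀ p : HalfPlaneSAW, (q p).support.Nodup := by
    intro p
    rw [hq_supp]
    exact (List.nodup_map_iff (add_left_injective c)).2
      ((SimpleGraph.Walk.isPath_def _).1 p.1.2)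
  have hq3 : ∀ p : HalfPlaneSAW, ∀ w ∈ (q p).support, 3 ≤ w 1 := by
    intro p w hw
    rw [hq_supp, List.mem_map] at hw
    obtain ⟨w', hw', rfl⟩ := hw
    have := p.2 w' hw'
    rw [hc]
    simp only [Pi.add_apply, Matrix.cons_val_one, Matrix.cons_val_zero]
    omega
  have hq_bounds : ∀ p : HalfPlaneSAW, ∀ w ∈ (q p).support,
      |w 0 + 1| ≤ p.1.1.length ∧ w 1 ≤ p.1.1.length + 3 := by
    intro p w hw
    rw [hq_supp, List.mem_map] at hw
    obtain ⟨w', hw', rfl⟩ := hw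
    have hb := abs_sub_le_length p.1.1 w' hw'
    have hb0 := hb 0
    have hb1 := hb 1
    rw [hc]
    simp only [Pi.add_apply, Matrix.cons_val_one, Matrix.cons_val_zero, Pi.zero_apply,
      sub_zero] at hb0 hb1 ⊢
    refine ⟨by rw [show w' 0 + -1 + 1 = w' 0 by ring]; exact hb0, ?_⟩
    have := (abs_le.1 hb1).2
    omega
  -- the sandwich in `ℤ²`
  let W : HalfPlaneSAW → (zdGraph 2).Walk (![-1, 0] : Site 2) ![0, 0] := fun p =>
    s.append ((q p).append h)
  have hW_supp : ∀ p, (W p).support = s.support ++ (q p).support.tail ++ h.support.tail :=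
    fun p => support_sandwich s (q p) h
  have hW_nodup : ∀ p, (W p).support.Nodup :=
    fun p => nodup_support_sandwich s (q p) h hs hh (hq_nodup p) (hq3 p)
  have hW_len : ∀ p, (W p).length = p.1.1.length + 8 := by
    intro p
    show (s.append ((q p).append h)).length = _
    rw [SimpleGraph.Walk.length_append, SimpleGraph.Walk.length_append, hq_len, hsl, hhl]
    ring
  have hW_mem : ∀ p : HalfPlaneSAW, p.1.1.length + 3 ≤ N → ∀ w ∈ (W p).support, w ∈ halfBox N := by
    intro p hp w hw
    rw [hW_supp, List.mem_append, List.mem_append] at hw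
    rcases hw with (hw | hw) | hw
    · exact mem_halfBox_of_mem_frame hN (Or.inl (hs ▸ hw))
    · have hw' := mem_support_of_mem_tail (q p) hw
      obtain ⟨hb0, hb1⟩ := hq_bounds p w hw'
      exact mem_halfBox_of_bounds hp hb0 hb1 (hq3 p w hw')
    · refine mem_halfBox_of_mem_frame hN (Or.inr ?_)
      have hw' : w ∈ h.support := mem_support_of_mem_tail h hw
      rwa [hh] at hw'
  -- the embedding
  refine ⟨fun p => ⟨(W p.1).transfer _ (edges_mem_edgeSet_halfBox hN2 (W p.1) (hW_mem p.1 p.2)),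
      ((SimpleGraph.Walk.isPath_def _).2 (hW_nodup p.1)).transfer _⟩, ?_, ?_⟩
  · -- injectivity: the support of the image determines the arch
    rintro ⟨p, hp⟩ ⟨p', hp'⟩ hTT
    have h1 : (W p).support = (W p').support := by
      have := congrArg (fun γ : DomainSAW (halfBoxDomain N) 1 ![-1, 0] ![0, 0] => γ.walk.support) hTT
      simpa only [SimpleGraph.Walk.support_transfer] using this
    rw [hW_supp, hW_supp] at h1
    have h2 : (q p).support.tail = (q p').support.tail :=
      List.append_cancel_left (List.append_cancel_right h1)
    have h3 : (q p).support = (q p').support := by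
      rw [← SimpleGraph.Walk.cons_tail_support (q p), ← SimpleGraph.Walk.cons_tail_support (q p'), h2]
    rw [hq_supp, hq_supp] at h3
    have h4 : p.1.1.support = p'.1.1.support :=
      List.map_injective_iff.2 (add_left_injective c) h3
    have h5 : p.1.1 = p'.1.1 := SimpleGraph.Walk.ext_support h4
    exact Subtype.ext (Subtype.ext (Subtype.ext h5))
  · intro p
    exact (SimpleGraph.Walk.length_transfer _ _).trans (hW_len p.1)

/-! ### Exhaustion: the notched half-box arch bound controls the half-plane bubble -/

/-- **`A ≤ x_c⁻⁸ · sup_N Z_{Λ_N}(b', b)`.** A uniform bound on the critical partition functions of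
the notched half-boxes between `b' = (-1,0)` and `b = (0,0)` bounds the critical half-plane bubble
`halfPlaneBubble = Σ_{arches 0 → e₀} x_c^{|γ|}`. [folklore] -/
theorem halfPlaneBubble_le_of_archBound {C : ℝ≥0∞}
    (hC : ∀ N : ℕ, 2 ≤ N → SAW.weight (halfBoxDomain N) 1 ![-1, 0] ![0, 0] univ ≤ C) :
    halfPlaneBubble ≤ (ENNReal.ofReal criticalFugacity)⁻¹ ^ 8 * C := by
  classical
  set x : ℝ≥0∞ := ENNReal.ofReal criticalFugacity with hx
  have hx0 : x ≠ 0 := (ENNReal.ofReal_pos.2 criticalFugacity_pos_lt_one'.1).ne'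
  have hxtop : x ≠ ⊤ := ENNReal.ofReal_ne_top
  rw [halfPlaneBubble, ENNReal.tsum_eq_iSup_sum]
  refine iSup_le fun s => ?_
  -- a common half-box for all arches of `s`
  set N : ℕ := s.sup (fun p => p.1.1.length) + 3 with hN
  have hN3 : 3 ≤ N := Nat.le_add_left 3 _
  have hlen : ∀ p ∈ s, p.1.1.length + 3 ≤ N := fun p hp =>
    Nat.add_le_add_right (Finset.le_sup (f := fun p : HalfPlaneSAW => p.1.1.length) hp) 3
  obtain ⟨T, hT, hTlen⟩ := exists_archEmbedding hN3
  let T' : {p // p ∈ s} → DomainSAW (halfBoxDomain N) 1 ![-1, 0] ![0, 0] :=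
    fun q => T ⟨q.1, hlen q.1 q.2⟩
  have hT' : ∀ a ∈ s.attach, ∀ b ∈ s.attach, T' a = T' b → a = b := by
    intro a _ b _ hab
    have := hT hab
    exact Subtype.ext (congrArg (fun r : {p : HalfPlaneSAW // p.1.1.length + 3 ≤ N} => r.1) this)
  -- the weight of an arch against the weight of its image
  have hw : ∀ q : {p // p ∈ s}, ENNReal.ofReal (criticalFugacity ^ q.1.1.1.length) =
      x⁻¹ ^ 8 * ENNReal.ofReal (criticalFugacity ^ (T' q).length) := by
    intro q
    have hl : (T' q).length = q.1.1.1.length + 8 := hTlen ⟨q.1, hlen q.1 q.2⟩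
    rw [hl, pow_add, ENNReal.ofReal_mul (pow_nonneg criticalFugacity_pos_lt_one'.1.le _),
      ENNReal.ofReal_pow criticalFugacity_pos_lt_one'.1.le 8, ← hx, mul_comm (x⁻¹ ^ 8),
      mul_assoc, ← mul_pow, ENNReal.mul_inv_cancel hx0 hxtop, one_pow, mul_one]
  calc ∑ p ∈ s, ENNReal.ofReal (criticalFugacity ^ p.1.1.length)
      = ∑ q ∈ s.attach, x⁻¹ ^ 8 * ENNReal.ofReal (criticalFugacity ^ (T' q).length) := by
        rw [← Finset.sum_attach]; exact Finset.sum_congr rfl fun q _ => hw q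
    _ = x⁻¹ ^ 8 * ∑ q ∈ s.attach, ENNReal.ofReal (criticalFugacity ^ (T' q).length) := by
        rw [Finset.mul_sum]
    _ = x⁻¹ ^ 8 * ∑ γ ∈ s.attach.image T', ENNReal.ofReal (criticalFugacity ^ γ.length) := by
        rw [Finset.sum_image hT']
    _ ≤ x⁻¹ ^ 8 * ∑' γ : DomainSAW (halfBoxDomain N) 1 ![-1, 0] ![0, 0],
          ENNReal.ofReal (criticalFugacity ^ γ.length) := by
        gcongr; exact ENNReal.sum_le_tsum _
    _ = x⁻¹ ^ 8 * SAW.weight (halfBoxDomain N) 1 ![-1, 0] ![0, 0] univ := by rw [weight_univ]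
    _ ≤ x⁻¹ ^ 8 * C := by gcongr; exact hC N (le_trans (by norm_num) hN3)

/-! ### Consequences for the item `BoundaryHarnack` -/

open Summit.CriticalPhenomena.SAWScalingLimit.Theses.SAWTotalPositivity (BoundaryHarnack CriticalBubbleBound)

/-- **`BoundaryHarnack ⇒ HalfPlaneBubbleFinite`.** The tip-uniform boundary Harnack comparability
of the route forces the finiteness of the critical half-plane bubble of `ℤ²`
(`A = Σ_{arches 0 → e₀ in {y ≥ 0}} x_c^{|γ|} < ∞`, the planner's foreseen layer-2 crux
`HalfPlaneBubble` of the `CriticalBubbleBound` chain) — a statement open in print on `ℤ²` (its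
hexagonal-lattice analogue is the Duminil-Copin–Smirnov arch bound). [folklore] -/
theorem halfPlaneBubbleFinite_of_boundaryHarnack (hBH : BoundaryHarnack) : HalfPlaneBubbleFinite := by
  obtain ⟨C, hC, hb⟩ := archBound_of_boundaryHarnack hBH
  refine ne_top_of_le_ne_top (ENNReal.mul_ne_top (ENNReal.pow_ne_top ?_) hC)
    (halfPlaneBubble_le_of_archBound hb)
  exact ENNReal.inv_ne_top.2 (ENNReal.ofReal_pos.2 criticalFugacity_pos_lt_one'.1).ne'

/-- **`BoundaryHarnack ⇒ Σ_N q_N x_c^N < ∞`**: the route's Harnack comparability forces the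
finiteness of the critical unrooted polygon mass `𝒫 = unrootedPolygonSeries` of `ℤ²`
(through `HalfPlaneBubbleFinite` and `unrootedPolygonSeries_le_halfPlaneBubble`), i.e. a summable
`θ > 1` polygon bound — also open in print. [folklore] -/
theorem unrootedPolygonSeries_ne_top_of_boundaryHarnack (hBH : BoundaryHarnack) :
    unrootedPolygonSeries ≠ ⊤ :=
  unrootedPolygonSeries_ne_top_of_halfPlaneBubbleFinite (halfPlaneBubbleFinite_of_boundaryHarnack hBH)

/-- **The typed chain around the item** (stmt-CriticalPhenomena-7120):
`CriticalBubbleBound ⇒ BoundaryHarnack ⇒ HalfPlaneBubbleFinite ⇒ 𝒫 < ∞` — the item is wedged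
between the bulk critical bubble of `ℤ²` (crux stmt-7117, `θ > 2` level) and the half-plane bubble /
unrooted polygon mass (`θ > 1` level); every member of the chain is open in print on `ℤ²`. [folklore] -/
theorem boundaryHarnack_chain :
    (CriticalBubbleBound → BoundaryHarnack) ∧ (BoundaryHarnack → HalfPlaneBubbleFinite) ∧
      (HalfPlaneBubbleFinite → unrootedPolygonSeries ≠ ⊤) :=
  ⟨boundaryHarnack_of_criticalBubbleBound, halfPlaneBubbleFinite_of_boundaryHarnack,
    unrootedPolygonSeries_ne_top_of_halfPlaneBubbleFinite⟩

end Summit.CriticalPhenomena.SAWScalingLimit.Theorems.BoundaryHarnack.Negative
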